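import Literature.MathematicalPhysics.QuantumFieldTheory.Balaban1983to89.B9SectBCodedChainL2
import Literature.MathematicalPhysics.QuantumFieldTheory.Balaban1983to89.B9SectBCodedChainAn
import Literature.MathematicalPhysics.QuantumFieldTheory.Balaban1983to89.B9SectBStepPosFamilyTransfer

/-!
# `Balaban1983to89.B9SectBEGlobAnStepRecordOn` — ★★★ the POSITIVE-INPUT (3.42) AND (3.47) BLOCK-STEPS `StepEPos` ∕ `StepGlobPos` AND THE ANALYTIC-EXTENSION
# STEP `StepAnalyticPos` OF THE RECORD's OWN FAMILY on a subfamily, from the root Sect.-B frame over the coded carrier (pub-ymgap N06 row 13, (O4) per-member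
# programme, members `e`, `glob`, `an` in the certificate's `StepPos` currency — the objects `B9SectBStepWhole.sectBStepPrinted_of_posBlockSteps` consumes;
# NO plaquette law needed)

T. Bałaban, *Propagators for lattice gauge theories in a background field*, Commun. Math. Phys. **99** (1985) 389–434
[`Balaban1985BackgroundPropagators`, "B9"]; [4] = T. Bałaban, *Propagators and renormalization transformations for lattice gauge
theories. II*, Commun. Math. Phys. **96** (1984) 223–250 [`Balaban1984PropagatorsII`].

statement-level skeleton of published theorems with citation tags; proofs where landed; nothing here is a claim about the
Yang–Mills mass gap

THE PRINTED LOCI.  Theorem 3.1 (3.42), (3.47) pp. 397–398 and the first remark of p. 398 ((3.47) from (3.42)); Theorem 3.4 p. 400, Sect. B pp. 400–407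
((3.60)–(3.64) p. 402: the expansion of G′(U′U) and its convergence in the (3.42) norms); p. 403 l.1–9 («of course with different constants»); [4] Lemma 2.1
p. 234.

WHY THIS FILE (seat dag-n06-c gen 11; chain owner dag-n06-d g10's interface word «StepPos currency», 2026-08-28; successor list of g9's
`B9SectBL2StepRecordOn`).  The root frame `GpFrame₂` over the coded carriers of a subfamily is INHABITED for g7's coded readings `KSC`
(`B9SectBCodedChainOnSubfamily.gpFrame₂CodedOn` with the dictionaries `read342Y_KSC` ∕ `write342Y_KSC`), so r06's uniform Theorem 3.4 gives the (3.42) block-step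
of `KSC` over the coded carrier (`B9SectBGpStepAtLettersV2.stepEPos_of_gpFrame₂`; §1).  It is transported to the record's own reading
`kernelFamilyS … (GpY par) par` over `bg9Y` by the GENERIC Step-level transfers of `B9SectBStepPosFamilyTransfer`: at the base g7's (3.42) conversion with
EXPLICIT positive constants (§2, `thms_KSC_base_of_pullK`); at `U′U` the letter conversion of the (3.42) block (`hconv_KSC_on`, §3) — for the `e` member — and
the same followed by print's «(3.47) from (3.42)» at `W = U′U` (`B9Ineq347SiteReadingY.globBlock_kernelFamilyS_of_eBlock`, §3) — for the `glob` member, whose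
coded reading is silent at products and is therefore RECOVERED from the `e` output (the generic transfer allows the output statement to change).  §4: ★★★
`stepEPos_record_on`, ★★★ `stepGlobPos_record_on`.  §5: the analytic-extension member — g8's `anFrame₂CodedOn` inhabited for `KSC` gives the coded step at
the coded predicate `IsAnKY` (`stepAnalyticPos1_of_anFrame₂`), the input families are exchanged by the generic transfer (the predicate ignores the family), and
`stepPos_base_of_coded` brings it to the record at g8's record pin `IsAnRecY r` (the exponent rescaling `r` of the class implication built in; `hOut = id`):
★★★ `stepAnalyticPos1_record_on`, ★★★ `stepAnalyticPos_record_on` (both halves — `IsAnRecY` does not read the kernel family).  Displayed: the class implication `hclass` (discharged for `C37Y` in `B9SectBCodedChainC37Y`) and the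
structural data of the root frame (`hpar`, `hunit`, `hC37`, thresholds); NO plaquette law (that enters only the `L²` member).
Value = the row-13 `e`, `glob` and analytic-extension block-steps in the certificate's currency; NOT summit progress; N06 is not discharged by this file.
-/

noncomputable section

namespace Literature.MathematicalPhysics.QuantumFieldTheory.Balaban1983to89.B9SectBEGlobAnStepRecordOn

open Literature.MathematicalPhysics.QuantumFieldTheory.Balaban1983to89
open Literature.MathematicalPhysics.QuantumFieldTheory.Balaban1983to89.B6Ineq2142KLevelV1 (β)
open Literature.MathematicalPhysics.QuantumFieldTheory.Balaban1983to89.B9FromB6 (EBlock GlobBlock)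
open Literature.MathematicalPhysics.QuantumFieldTheory.Balaban1983to89.B9SectBCodedCarrier (CCfg Coding pullK pullS)
open Literature.MathematicalPhysics.QuantumFieldTheory.Balaban1983to89.B9Eq360DeltaPrimeAY (AfldY mulY)
open Literature.MathematicalPhysics.QuantumFieldTheory.Balaban1983to89.B9PinMembersKLevelV1 (MemberY geo9Y bg9Y)
open Literature.MathematicalPhysics.QuantumFieldTheory.Balaban1983to89.B9SectBGpLettersY (GVal)
open Literature.MathematicalPhysics.QuantumFieldTheory.Balaban1983to89.B9SectBGpFrameCodedY (codingYx CplxLettersY)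
open Literature.MathematicalPhysics.QuantumFieldTheory.Balaban1983to89.B9SectBGpReadingsY (KSC read342Y_KSC write342Y_KSC)
open Literature.MathematicalPhysics.QuantumFieldTheory.Balaban1983to89.B9SectBGpTransferInY (thms_KSC_base_of_pullK eBlock_mono)
open Literature.MathematicalPhysics.QuantumFieldTheory.Balaban1983to89.B9SectBGpStepAtLettersV2 (stepEPos_of_gpFrame₂)
open Literature.MathematicalPhysics.QuantumFieldTheory.Balaban1983to89.B9SectBCodedChainOnSubfamily (gpFrame₂CodedOn hconv_KSC_on)
open Literature.MathematicalPhysics.QuantumFieldTheory.Balaban1983to89.B9Ineq347SiteReadingY (globBlock_kernelFamilyS_of_eBlock)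
open Literature.MathematicalPhysics.QuantumFieldTheory.Balaban1983to89.B9SectBCodedChainL2 (thms_mono_B₀)
open Literature.MathematicalPhysics.QuantumFieldTheory.Balaban1983to89.B9SectBStepPosFamilyTransfer (stepEPos_of_family_pos stepEPos_of_coded
  stepPos_blk_of_family_pos stepGlobPos_of_coded stepPos_of_family_pos stepPos_base_of_coded)
open Literature.MathematicalPhysics.QuantumFieldTheory.Balaban1983to89.B9SectBStepWhole (StepEPos StepGlobPos StepAnalyticPos1 StepAnalyticPos
  stepAnalyticPos_of_halves)
open Literature.MathematicalPhysics.QuantumFieldTheory.Balaban1983to89.B9SectBGpStepAtLettersV2 (stepAnalyticPos1_of_anFrame₂)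
open Literature.MathematicalPhysics.QuantumFieldTheory.Balaban1983to89.B9SectBCodedChainAn (IsAnKY IsAnRecY anFrame₂CodedOn)
open Literature.MathematicalPhysics.QuantumFieldTheory.Balaban1983to89.B9GeoNbrCountKLevelV1 (exists_card_nbr_geo9Y_le_of_M)
open Literature.MathematicalPhysics.QuantumFieldTheory.Balaban1983to89.B9GeoNormsKLevelV1 (geo9K_wNorm_nonneg)
open Literature.MathematicalPhysics.QuantumFieldTheory.Balaban1983to89.Node00 (SiteY BlkY IBondY CfgY SiteParY deltaPrimeAY kernelFamilyS GpY)

variable {d ℓ : ℕ} {hd : 1 ≤ d + 1} {hL : Odd (ℓ + 1) ∧ 1 < ℓ + 1} {b₀ b₁ : ℝ} {Mstar : ℕ}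
variable {𝔸 : Type} [NormedRing 𝔸] [NormedAlgebra ℂ 𝔸] [CompleteSpace 𝔸] [NormOneClass 𝔸] [FiniteDimensional ℝ 𝔸]

variable {J : Type} (f : J → MemberY d ℓ hd hL b₀ b₁ Mstar) [∀ x : MemberY d ℓ hd hL b₀ b₁ Mstar, Fintype (geo9Y x).Site]
  [instDS : ∀ x : MemberY d ℓ hd hL b₀ b₁ Mstar, DecidableEq (geo9Y x).Site] [instNE : ∀ x : MemberY d ℓ hd hL b₀ b₁ Mstar, Nonempty (geo9Y x).Site]
  (c35 : ℝ) (G : Subgroup 𝔸ˣ) (par : ∀ j : J, SiteParY 𝔸 (f j).toKIdx) {ι : Type} [Fintype ι] [DecidableEq ι] (b : Module.Basis ι ℝ 𝔸)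
  (ιB : ∀ j : J, BlkY (f j).toKIdx → IBondY (f j).toKIdx)
  (C37 C38 : ∀ j : J, ℝ → CfgY 𝔸 (f j).toKIdx → AfldY 𝔸 (f j).toKIdx → Prop)

/-! ## §1  The (3.42) block-step of the coded readings `KSC` over the coded carrier (the root frame's output) -/

/-- ★ **`StepEPos` OF THE CODED FAMILY `KSC` OVER THE CODED CARRIERS OF A SUBFAMILY** — r06's uniform Theorem 3.4 for G′ at letters
(`stepEPos_of_gpFrame₂`) on the root frame `gpFrame₂CodedOn` inhabited for `KSC` (dictionaries `read342Y_KSC` ∕ `write342Y_KSC`, reading constant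
`c_R = M₂Σ‖b_j‖ > 0`, writing functions `(c_R·B + 1, δ)`); any shared families `GA`, `Cinv` over the coded background.
[cite: Balaban1985BackgroundPropagators, Thm 3.4 p.400, (3.60)–(3.64) p.402, Thm 3.1 (3.42) p.397, (3.35)–(3.37) p.396; Balaban1984PropagatorsII, Lemma 2.1 p.234, (2.51) p.232] -/
theorem stepEPos_KSC_on (hι : ∀ (j : J) (s : BlkY (f j).toKIdx), β (f j).toKIdx.hN (f j).toKIdx.D (f j).toKIdx.hk (ιB j s) = s)
    (hG1 : ∀ u : 𝔸ˣ, u ∈ G → ‖(u : 𝔸)‖ ≤ 1) (hpar : ∀ j (U : CfgY 𝔸 (f j).toKIdx), GVal G (f j).toKIdx U → ∀ z w, par j U z w ∈ G)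
    (hunit : ∀ j (U : CfgY 𝔸 (f j).toKIdx), GVal G (f j).toKIdx U → IsUnit (deltaPrimeAY (f j).toKIdx (par j) U))
    (dB : ℕ) (M₂ : ℝ) (hM₂ : 0 ≤ M₂) (hrepr : ∀ (v : 𝔸) (j : ι), |b.repr v j| ≤ M₂ * ‖v‖) (hcR : 0 < M₂ * ∑ j, ‖b j‖)
    (Cq : ℝ) (hCq : 0 ≤ Cq) (hC37 : ∀ j β' U a, C37 j β' U a → GVal G (f j).toKIdx U ∧ CplxLettersY G (f j) (par j) (ιB j) Cq β' U a)
    (MInv aInv aW : ℝ) (hMInv : 0 < MInv) (haInv : 0 < aInv) (haW : 0 < aW)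
    (GA : ∀ j : J, B9.KernelFamily (geo9Y (f j)) (codingYx G (f j) (C37 j) (C38 j)).bg)
    (Cinv : ∀ j : J, B9.SiteKernel (geo9Y (f j)) (codingYx G (f j) (C37 j) (C38 j)).bg) :
    StepEPos dB c35 (fun j => geo9Y (f j)) (fun j => (codingYx G (f j) (C37 j) (C38 j)).bg) (fun j => KSC G (f j) (par j) (C37 j) (C38 j)) GA Cinv
      (fun j => KSC G (f j) (par j) (C37 j) (C38 j)) :=
  stepEPos_of_gpFrame₂ (d := dB)
    (gpFrame₂CodedOn f c35 G b C37 C38 par ιB (fun j => KSC G (f j) (par j) (C37 j) (C38 j)) hι hG1 hpar hunit dB M₂ hM₂ hrepr Cq hCq hC37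
      (M₂ * ∑ j, ‖b j‖) hcR (fun B _ => (M₂ * ∑ j, ‖b j‖) * B + 1) (fun B _ hB _ => by positivity) (fun δ => δ) (fun δ hδ => hδ)
      MInv aInv aW hMInv haInv haW (fun j => read342Y_KSC G (f j) (par j) b (ιB j) (C37 j) (C38 j) (hι j) M₂ hM₂ hrepr c35 MInv aInv)
      (fun j => write342Y_KSC G (f j) (par j) b (ιB j) (C37 j) (C38 j) (hι j) M₂ hM₂ hrepr aW fun β' U a h => (hC37 j β' U a h).1))
    GA Cinv

/-! ## §2  The input domination with explicit positive constants (plaquette-free) -/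

omit [NormOneClass 𝔸] [FiniteDimensional ℝ 𝔸] [DecidableEq ι] instDS instNE in
/-- ★ **`hin` FOR `KSC` WITH POSITIVE OUTPUT CONSTANTS**: at every (3.35)-regular base above `max ML (2(d+1)+1)`, the record family's Theorem-3.1–3.3 block
(read along the decoding) with constants `(B₀, δ₀, B_β, B_ε, B_εβ, B₁, δ₁)`, `B₀ > 0`, gives `KSC`'s with `(max (c_in·B₀) 1, δ₀, B_β, B_ε, B_εβ, B₁, δ₁)` —
g7's (3.42) conversion `thms_KSC_base_of_pullK` (neighbour count `exists_card_nbr_geo9Y_le_of_M`), the constant enlarged to be positive.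
[cite: Balaban1985BackgroundPropagators, Thms 3.1–3.3 (3.42)–(3.48) pp.397–399, (3.35) p.396; Balaban1984PropagatorsII, (2.51) p.232] -/
theorem hin_KSC_on_pos (hι : ∀ (j : J) (s : BlkY (f j).toKIdx), β (f j).toKIdx.hN (f j).toKIdx.D (f j).toKIdx.hk (ιB j s) = s)
    (hG1 : ∀ u : 𝔸ˣ, u ∈ G → ‖(u : 𝔸)‖ ≤ 1) {M₂ : ℝ} (hM₂ : 0 ≤ M₂) (hrepr : ∀ (v : 𝔸) (j : ι), |b.repr v j| ≤ M₂ * ‖v‖) (dC : ℕ)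
    (GA : ∀ j : J, B9.KernelFamily (geo9Y (f j)) (codingYx G (f j) (C37 j) (C38 j)).bg)
    (Cinv : ∀ j : J, B9.SiteKernel (geo9Y (f j)) (codingYx G (f j) (C37 j) (C38 j)).bg) :
    ∀ (B₀ δ₀ : ℝ) (Bβ Bε : ℝ → ℝ) (Bεβ : ℝ → ℝ → ℝ) (B₁ δ₁ : ℝ), 0 < B₀ → 0 < δ₀ → 0 < B₁ → 0 < δ₁ →
      ∃ (Mi ai B₀' δ₀' : ℝ) (Bβ' Bε' : ℝ → ℝ) (Bεβ' : ℝ → ℝ → ℝ) (B₁' δ₁' : ℝ), 0 < ai ∧ 0 < B₀' ∧ 0 < δ₀' ∧ 0 < B₁' ∧ 0 < δ₁' ∧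
        ∀ j : J, Mi ≤ (geo9Y (f j)).M → ∀ α₀ : ℝ, 0 < α₀ → (geo9Y (f j)).M * α₀ ≤ ai →
          ∀ c : (codingYx G (f j) (C37 j) (C38 j)).bg.Cfg, (codingYx G (f j) (C37 j) (C38 j)).bg.Reg335 c35 α₀ c →
          B9.Thms31to33IneqAt dC (pullK (codingYx G (f j) (C37 j) (C38 j))
              (kernelFamilyS (f j).toKIdx (bg9Y 𝔸 G (f j)) (fun U => U) (GpY (f j).toKIdx (par j)) (par j)))
              (GA j) (Cinv j) B₀ δ₀ Bβ Bε Bεβ B₁ δ₁ c →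
          B9.Thms31to33IneqAt dC (KSC G (f j) (par j) (C37 j) (C38 j)) (GA j) (Cinv j) B₀' δ₀' Bβ' Bε' Bεβ' B₁' δ₁' c := by
  intro B₀ δ₀ Bβ Bε Bεβ B₁ δ₁ hB₀ hδ₀ hB₁ hδ₁
  obtain ⟨ML, mN, hcnt⟩ := exists_card_nbr_geo9Y_le_of_M (d := d) (ℓ := ℓ) (hd := hd) (hL := hL) (b₀ := b₀) (b₁ := b₁) (2 * ((d : ℝ) + 1))
  set cIn : ℝ := ((ℓ + 1 : ℕ) : ℝ) * Real.exp (|δ₀| * (2 * ((d : ℝ) + 1))) + ((mN : ℝ) * (M₂ * ∑ j, ‖b j‖) * Real.exp (|δ₀| * (2 * ((d : ℝ) + 1))) + 1)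
    with hcIn
  refine ⟨max ML (2 * ((d : ℝ) + 1) + 1), 1, max (cIn * max B₀ 0) 1, δ₀, Bβ, Bε, Bεβ, B₁, δ₁, one_pos, lt_max_of_lt_right one_pos, hδ₀, hB₁, hδ₁,
    fun j hM α₀ _ _ c hreg hT => ?_⟩
  obtain ⟨U, rfl, hU335⟩ := (codingYx G (f j) (C37 j) (C38 j)).exists_of_bg_Reg335 hreg
  have hU : GVal G (f j).toKIdx U := hU335.1.1
  have hM2 : 2 * ((d : ℝ) + 1) < (geo9Y (f j)).M := by
    have := le_trans (le_max_right _ _) hM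
    linarith
  have hML : ML ≤ (geo9Y (f j)).M := le_trans (le_max_left _ _) hM
  exact thms_mono_B₀ G (f j) (C37 j) (C38 j) dC _ (GA j) (Cinv j) (le_max_left _ _)
    (thms_KSC_base_of_pullK G (f j) (par j) b (ιB j) (C37 j) (C38 j) (hι j) hG1 hU hM₂ hrepr hM2 (fun a => hcnt Mstar (f j) hML a) dC (GA j)
      (Cinv j) hT)

/-! ## §3  The output dominations at `U′U`: the `e` member converted, the `glob` member recovered from it -/

omit [NormOneClass 𝔸] [DecidableEq ι] instDS instNE in
/-- ★ **THE (3.42) OUTPUT DOMINATION AT `U′U`**: for `(B, δ) > 0` and a cap `a`, above `hconv_KSC_on`'s threshold and for `α₁ ≦ min a (1/4)`, `KSC`'s (3.42)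
block at the product gives the record family's (read along the decoding) with `(max B″ 1, δ/2)` — the letter conversion of the (3.42) block
(`B9SectBCodedChainOnSubfamily.hconv_KSC_on`: `B9SectBGpTransferConvY.hconv_at` at the members).
[cite: Balaban1985BackgroundPropagators, p.403 l.1–9, (3.42) p.397, (3.70) p.404, (3.74) p.405; Balaban1984PropagatorsII, Lemma 2.1 (2.59)–(2.61) pp.233–234] -/
theorem houtE_KSC_on (hG1 : ∀ u : 𝔸ˣ, u ∈ G → ‖(u : 𝔸)‖ ≤ 1) {M₂ : ℝ} (hM₂ : 0 ≤ M₂) (hrepr : ∀ (v : 𝔸) (j : ι), |b.repr v j| ≤ M₂ * ‖v‖)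
    (hι : ∀ (j : J) (s : BlkY (f j).toKIdx), β (f j).toKIdx.hN (f j).toKIdx.D (f j).toKIdx.hk (ιB j s) = s)
    {Cq : ℝ} (hC37 : ∀ j β' U a, C37 j β' U a → GVal G (f j).toKIdx U ∧ CplxLettersY G (f j) (par j) (ιB j) Cq β' U a) :
    ∀ (B δ a : ℝ), 0 < B → 0 < δ → 0 < a →
      ∃ (Mo ao a' B' δ' : ℝ), 0 < ao ∧ 0 < a' ∧ a' ≤ a ∧ 0 < B' ∧ 0 < δ' ∧
        ∀ j : J, Mo ≤ (geo9Y (f j)).M → ∀ α₀ : ℝ, 0 < α₀ → (geo9Y (f j)).M * α₀ ≤ ao →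
          ∀ c : (codingYx G (f j) (C37 j) (C38 j)).bg.Cfg, (codingYx G (f j) (C37 j) (C38 j)).bg.Reg335 c35 α₀ c →
          ∀ α₁ : ℝ, 0 < α₁ → α₁ ≤ a' → ∀ c' : (codingYx G (f j) (C37 j) (C38 j)).bg.Cfg, (codingYx G (f j) (C37 j) (C38 j)).bg.Cplx337 α₁ c c' →
          EBlock (KSC G (f j) (par j) (C37 j) (C38 j)) B δ ((codingYx G (f j) (C37 j) (C38 j)).bg.mul c' c) →
          EBlock (pullK (codingYx G (f j) (C37 j) (C38 j))
            (kernelFamilyS (f j).toKIdx (bg9Y 𝔸 G (f j)) (fun U => U) (GpY (f j).toKIdx (par j)) (par j))) B' δ'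
            ((codingYx G (f j) (C37 j) (C38 j)).bg.mul c' c) := by
  intro B δ a hB hδ ha
  obtain ⟨Mo, B'', hB'', H⟩ := hconv_KSC_on f G par b ιB C37 C38 hG1 hM₂ hrepr hι hC37 B δ hB.le hδ
  refine ⟨Mo, 1, min a (1 / 4), max B'' 1, δ / 2, one_pos, lt_min ha (by norm_num), min_le_left _ _, lt_max_of_lt_right one_pos, half_pos hδ,
    fun j hM α₀ _ _ c _ α₁ _ hα₁a c' h37 hE => ?_⟩
  obtain ⟨U, a', rfl, rfl, hC⟩ := (codingYx G (f j) (C37 j) (C38 j)).exists_of_bg_Cplx337 h37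
  have hα₁c : α₁ ≤ 1 / 4 := hα₁a.trans (min_le_right _ _)
  have hconv := H j hM U a' α₁ hα₁c hC hE
  exact eBlock_mono (f j).toKIdx
    (pullK (codingYx G (f j) (C37 j) (C38 j)) (kernelFamilyS (f j).toKIdx (bg9Y 𝔸 G (f j)) (fun U => U) (GpY (f j).toKIdx (par j)) (par j)))
    (U := .prod U a') (le_max_left B'' 1) hconv

omit [NormOneClass 𝔸] [DecidableEq ι] instDS instNE in
/-- ★ **THE (3.47) OUTPUT RECOVERED AT `W = U′U` FROM THE (3.42) OUTPUT**: for `(B, δ) > 0` and a cap `a`, above `max Mo Mg` and for `α₁ ≦ min a (1/4)`,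
`KSC`'s (3.42) block at the product gives the record family's (3.47) block at `W` (read along the decoding) with the constant `max (B″·C_g) 1` — the letter
conversion of the (3.42) block followed by print's remark «(3.47) follows from (3.42)» at `W` (`B9Ineq347SiteReadingY.globBlock_kernelFamilyS_of_eBlock` at the
rate `δ/2`).  The coded `glob` reading is silent at products; its information is carried by the `e` member.
[cite: Balaban1985BackgroundPropagators, (3.47) p.398 + p.398 first remark, p.403 l.1–9, (3.42) p.397; Balaban1984PropagatorsII, Lemma 2.1 (2.60)–(2.61) p.234] -/
theorem houtEGlob_KSC_on (hG1 : ∀ u : 𝔸ˣ, u ∈ G → ‖(u : 𝔸)‖ ≤ 1) {M₂ : ℝ} (hM₂ : 0 ≤ M₂) (hrepr : ∀ (v : 𝔸) (j : ι), |b.repr v j| ≤ M₂ * ‖v‖)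
    (hι : ∀ (j : J) (s : BlkY (f j).toKIdx), β (f j).toKIdx.hN (f j).toKIdx.D (f j).toKIdx.hk (ιB j s) = s)
    {Cq : ℝ} (hC37 : ∀ j β' U a, C37 j β' U a → GVal G (f j).toKIdx U ∧ CplxLettersY G (f j) (par j) (ιB j) Cq β' U a) :
    ∀ (B δ a : ℝ), 0 < B → 0 < δ → 0 < a →
      ∃ (Mo ao a' B' : ℝ), 0 < ao ∧ 0 < a' ∧ a' ≤ a ∧ 0 < B' ∧
        ∀ j : J, Mo ≤ (geo9Y (f j)).M → ∀ α₀ : ℝ, 0 < α₀ → (geo9Y (f j)).M * α₀ ≤ ao →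
          ∀ c : (codingYx G (f j) (C37 j) (C38 j)).bg.Cfg, (codingYx G (f j) (C37 j) (C38 j)).bg.Reg335 c35 α₀ c →
          ∀ α₁ : ℝ, 0 < α₁ → α₁ ≤ a' → ∀ c' : (codingYx G (f j) (C37 j) (C38 j)).bg.Cfg, (codingYx G (f j) (C37 j) (C38 j)).bg.Cplx337 α₁ c c' →
          EBlock (KSC G (f j) (par j) (C37 j) (C38 j)) B δ ((codingYx G (f j) (C37 j) (C38 j)).bg.mul c' c) →
          GlobBlock (pullK (codingYx G (f j) (C37 j) (C38 j))
            (kernelFamilyS (f j).toKIdx (bg9Y 𝔸 G (f j)) (fun U => U) (GpY (f j).toKIdx (par j)) (par j))) B'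
            ((codingYx G (f j) (C37 j) (C38 j)).bg.mul c' c) := by
  intro B δ a hB hδ ha
  obtain ⟨Mo, B'', hB'', H⟩ := hconv_KSC_on f G par b ιB C37 C38 hG1 hM₂ hrepr hι hC37 B δ hB.le hδ
  obtain ⟨Mg, Cg, hCg, HG⟩ := globBlock_kernelFamilyS_of_eBlock (d := d) (ℓ := ℓ) (hd := hd) (hL := hL) (b₀ := b₀) (b₁ := b₁) (Mstar := Mstar)
    (𝔸 := 𝔸) (half_pos hδ)
  refine ⟨max Mo Mg, 1, min a (1 / 4), max (B'' * Cg) 1, one_pos, lt_min ha (by norm_num), min_le_left _ _, lt_max_of_lt_right one_pos,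
    fun j hM α₀ _ _ c _ α₁ _ hα₁a c' h37 hE => ?_⟩
  obtain ⟨U, a', rfl, rfl, hC⟩ := (codingYx G (f j) (C37 j) (C38 j)).exists_of_bg_Cplx337 h37
  have hMo : Mo ≤ (geo9Y (f j)).M := le_trans (le_max_left _ _) hM
  have hMg : Mg ≤ (geo9Y (f j)).M := le_trans (le_max_right _ _) hM
  have hα₁c : α₁ ≤ 1 / 4 := hα₁a.trans (min_le_right _ _)
  have hconv := H j hMo U a' α₁ hα₁c hC hE
  have hglob := HG (f j) (ιB j) (hι j) hMg (bg9Y 𝔸 G (f j)) (fun U => U) (GpY (f j).toKIdx (par j)) (par j) _ B'' hB'' hconv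
  intro n lam γ hγ₁ hγ₂
  exact (hglob n lam γ hγ₁ hγ₂).trans (mul_le_mul_of_nonneg_right (le_max_left _ _) (geo9K_wNorm_nonneg (f j).toKIdx γ lam))

/-! ## §4  ★★★ The positive-input (3.42) and (3.47) block-steps of the record family on a subfamily -/

/-- ★★★ **`StepEPos` OF THE RECORD FAMILY ON A SUBFAMILY** (input families: the record's `kernelFamilyS … (GpY par) par`, `GA`, `Cinv` over `bg9Y`; output:
the record's (3.42) block of G′ at `U′U`): from §1 by `stepEPos_of_family_pos` (§2, §3) and `stepEPos_of_coded` (class implication `hclass`).  Displayed: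
`hclass` and the root frame's structural data; no plaquette law.
[cite: Balaban1985BackgroundPropagators, Thm 3.1 (3.42) p.397, Thm 3.4 p.400, (3.60)–(3.64) p.402, p.403 l.1–9, (3.35)–(3.37) p.396; Balaban1984PropagatorsII, Lemma 2.1 p.234, (2.51) p.232] -/
theorem stepEPos_record_on (hι : ∀ (j : J) (s : BlkY (f j).toKIdx), β (f j).toKIdx.hN (f j).toKIdx.D (f j).toKIdx.hk (ιB j s) = s)
    (hG1 : ∀ u : 𝔸ˣ, u ∈ G → ‖(u : 𝔸)‖ ≤ 1) (hpar : ∀ j (U : CfgY 𝔸 (f j).toKIdx), GVal G (f j).toKIdx U → ∀ z w, par j U z w ∈ G)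
    (hunit : ∀ j (U : CfgY 𝔸 (f j).toKIdx), GVal G (f j).toKIdx U → IsUnit (deltaPrimeAY (f j).toKIdx (par j) U))
    (dB : ℕ) (M₂ : ℝ) (hM₂ : 0 ≤ M₂) (hrepr : ∀ (v : 𝔸) (j : ι), |b.repr v j| ≤ M₂ * ‖v‖) (hcR : 0 < M₂ * ∑ j, ‖b j‖)
    (Cq : ℝ) (hCq : 0 ≤ Cq) (hC37 : ∀ j β' U a, C37 j β' U a → GVal G (f j).toKIdx U ∧ CplxLettersY G (f j) (par j) (ιB j) Cq β' U a)
    (MInv aInv aW : ℝ) (hMInv : 0 < MInv) (haInv : 0 < aInv) (haW : 0 < aW)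
    (GA : ∀ j : J, B9.KernelFamily (geo9Y (f j)) (bg9Y 𝔸 G (f j))) (Cinv : ∀ j : J, B9.SiteKernel (geo9Y (f j)) (bg9Y 𝔸 G (f j)))
    {r αcap Mc ac : ℝ} (hr : 0 < r) (hcap : 0 < αcap) (hac : 0 < ac)
    (hclass : ∀ (j : J) (α₀ α₁ : ℝ) (U U' : (bg9Y 𝔸 G (f j)).Cfg), Mc ≤ (geo9Y (f j)).M → 0 < α₀ → (geo9Y (f j)).M * α₀ ≤ ac →
      (bg9Y 𝔸 G (f j)).Reg335 c35 α₀ U → 0 < α₁ → α₁ ≤ αcap → (bg9Y 𝔸 G (f j)).Cplx337 α₁ U U' →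
      ∃ a : (codingYx G (f j) (C37 j) (C38 j)).A,
        (codingYx G (f j) (C37 j) (C38 j)).decA a = U' ∧ (codingYx G (f j) (C37 j) (C38 j)).C37 (r * α₁) U a) :
    StepEPos dB c35 (fun j => geo9Y (f j)) (fun j => bg9Y 𝔸 G (f j))
      (fun j => kernelFamilyS (f j).toKIdx (bg9Y 𝔸 G (f j)) (fun U => U) (GpY (f j).toKIdx (par j)) (par j)) GA Cinv
      (fun j => kernelFamilyS (f j).toKIdx (bg9Y 𝔸 G (f j)) (fun U => U) (GpY (f j).toKIdx (par j)) (par j)) := by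
  refine stepEPos_of_coded dB c35 (fun j => geo9Y (f j)) (fun j => bg9Y 𝔸 G (f j))
    (fun j => kernelFamilyS (f j).toKIdx (bg9Y 𝔸 G (f j)) (fun U => U) (GpY (f j).toKIdx (par j)) (par j)) GA Cinv
    (fun j => kernelFamilyS (f j).toKIdx (bg9Y 𝔸 G (f j)) (fun U => U) (GpY (f j).toKIdx (par j)) (par j))
    (fun j => codingYx G (f j) (C37 j) (C38 j)) hr hcap hac hclass ?_
  exact stepEPos_of_family_pos dB c35 (fun j => geo9Y (f j)) (fun j => (codingYx G (f j) (C37 j) (C38 j)).bg)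
    (fun j => KSC G (f j) (par j) (C37 j) (C38 j))
    (fun j => pullK (codingYx G (f j) (C37 j) (C38 j)) (kernelFamilyS (f j).toKIdx (bg9Y 𝔸 G (f j)) (fun U => U) (GpY (f j).toKIdx (par j)) (par j)))
    (fun j => pullK (codingYx G (f j) (C37 j) (C38 j)) (GA j)) (fun j => pullK (codingYx G (f j) (C37 j) (C38 j)) (GA j))
    (fun j => pullS (codingYx G (f j) (C37 j) (C38 j)) (Cinv j))
    (fun j => KSC G (f j) (par j) (C37 j) (C38 j))
    (fun j => pullK (codingYx G (f j) (C37 j) (C38 j)) (kernelFamilyS (f j).toKIdx (bg9Y 𝔸 G (f j)) (fun U => U) (GpY (f j).toKIdx (par j)) (par j)))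
    (hin_KSC_on_pos f c35 G par b ιB C37 C38 hι hG1 hM₂ hrepr dB _ _)
    (houtE_KSC_on f c35 G par b ιB C37 C38 hG1 hM₂ hrepr hι hC37)
    (stepEPos_KSC_on f c35 G par b ιB C37 C38 hι hG1 hpar hunit dB M₂ hM₂ hrepr hcR Cq hCq hC37 MInv aInv aW hMInv haInv haW _ _)

/-- ★★★ **`StepGlobPos` OF THE RECORD FAMILY ON A SUBFAMILY** (the record's (3.47) block of G′ at `U′U` from its Theorem-3.1–3.3 blocks at `U`): from the
coded (3.42) step of §1 by the generic transfer `stepPos_blk_of_family_pos` with the CHANGED output statement (§3 `houtEGlob_KSC_on`: the (3.47) block at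
`W` recovered from the converted (3.42) block) and `stepGlobPos_of_coded`.  Displayed: `hclass` and the root frame's structural data; no plaquette law.
[cite: Balaban1985BackgroundPropagators, Thm 3.1 (3.47) p.398 + p.398 first remark, Thm 3.4 p.400, p.402 («all the statements (3.42)–(3.47) for G′(U′U)»), p.403 l.1–9, (3.35)–(3.37) p.396; Balaban1984PropagatorsII, Lemma 2.1 p.234] -/
theorem stepGlobPos_record_on (hι : ∀ (j : J) (s : BlkY (f j).toKIdx), β (f j).toKIdx.hN (f j).toKIdx.D (f j).toKIdx.hk (ιB j s) = s)
    (hG1 : ∀ u : 𝔸ˣ, u ∈ G → ‖(u : 𝔸)‖ ≤ 1) (hpar : ∀ j (U : CfgY 𝔸 (f j).toKIdx), GVal G (f j).toKIdx U → ∀ z w, par j U z w ∈ G)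
    (hunit : ∀ j (U : CfgY 𝔸 (f j).toKIdx), GVal G (f j).toKIdx U → IsUnit (deltaPrimeAY (f j).toKIdx (par j) U))
    (dB : ℕ) (M₂ : ℝ) (hM₂ : 0 ≤ M₂) (hrepr : ∀ (v : 𝔸) (j : ι), |b.repr v j| ≤ M₂ * ‖v‖) (hcR : 0 < M₂ * ∑ j, ‖b j‖)
    (Cq : ℝ) (hCq : 0 ≤ Cq) (hC37 : ∀ j β' U a, C37 j β' U a → GVal G (f j).toKIdx U ∧ CplxLettersY G (f j) (par j) (ιB j) Cq β' U a)
    (MInv aInv aW : ℝ) (hMInv : 0 < MInv) (haInv : 0 < aInv) (haW : 0 < aW)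
    (GA : ∀ j : J, B9.KernelFamily (geo9Y (f j)) (bg9Y 𝔸 G (f j))) (Cinv : ∀ j : J, B9.SiteKernel (geo9Y (f j)) (bg9Y 𝔸 G (f j)))
    {r αcap Mc ac : ℝ} (hr : 0 < r) (hcap : 0 < αcap) (hac : 0 < ac)
    (hclass : ∀ (j : J) (α₀ α₁ : ℝ) (U U' : (bg9Y 𝔸 G (f j)).Cfg), Mc ≤ (geo9Y (f j)).M → 0 < α₀ → (geo9Y (f j)).M * α₀ ≤ ac →
      (bg9Y 𝔸 G (f j)).Reg335 c35 α₀ U → 0 < α₁ → α₁ ≤ αcap → (bg9Y 𝔸 G (f j)).Cplx337 α₁ U U' →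
      ∃ a : (codingYx G (f j) (C37 j) (C38 j)).A,
        (codingYx G (f j) (C37 j) (C38 j)).decA a = U' ∧ (codingYx G (f j) (C37 j) (C38 j)).C37 (r * α₁) U a) :
    StepGlobPos dB c35 (fun j => geo9Y (f j)) (fun j => bg9Y 𝔸 G (f j))
      (fun j => kernelFamilyS (f j).toKIdx (bg9Y 𝔸 G (f j)) (fun U => U) (GpY (f j).toKIdx (par j)) (par j)) GA Cinv
      (fun j => kernelFamilyS (f j).toKIdx (bg9Y 𝔸 G (f j)) (fun U => U) (GpY (f j).toKIdx (par j)) (par j)) := by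
  refine stepGlobPos_of_coded dB c35 (fun j => geo9Y (f j)) (fun j => bg9Y 𝔸 G (f j))
    (fun j => kernelFamilyS (f j).toKIdx (bg9Y 𝔸 G (f j)) (fun U => U) (GpY (f j).toKIdx (par j)) (par j)) GA Cinv
    (fun j => kernelFamilyS (f j).toKIdx (bg9Y 𝔸 G (f j)) (fun U => U) (GpY (f j).toKIdx (par j)) (par j))
    (fun j => codingYx G (f j) (C37 j) (C38 j)) hr hcap hac hclass ?_
  refine stepPos_blk_of_family_pos dB c35 (fun j => geo9Y (f j)) (fun j => (codingYx G (f j) (C37 j) (C38 j)).bg)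
    (fun j => KSC G (f j) (par j) (C37 j) (C38 j))
    (fun j => pullK (codingYx G (f j) (C37 j) (C38 j)) (kernelFamilyS (f j).toKIdx (bg9Y 𝔸 G (f j)) (fun U => U) (GpY (f j).toKIdx (par j)) (par j)))
    (fun j => pullK (codingYx G (f j) (C37 j) (C38 j)) (GA j)) (fun j => pullK (codingYx G (f j) (C37 j) (C38 j)) (GA j))
    (fun j => pullS (codingYx G (f j) (C37 j) (C38 j)) (Cinv j))
    (C₁ := ℝ × ℝ) (C₂ := ℝ) (pos₁ := fun c => 0 < c.1 ∧ 0 < c.2) (pos₂ := fun c => 0 < c)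
    (Blk₁ := fun c j W => EBlock (KSC G (f j) (par j) (C37 j) (C38 j)) c.1 c.2 W)
    (Blk₂ := fun c j W => GlobBlock (pullK (codingYx G (f j) (C37 j) (C38 j))
      (kernelFamilyS (f j).toKIdx (bg9Y 𝔸 G (f j)) (fun U => U) (GpY (f j).toKIdx (par j)) (par j))) c W)
    (hin_KSC_on_pos f c35 G par b ιB C37 C38 hι hG1 hM₂ hrepr dB _ _) (fun c hc a ha => ?_)
    (stepEPos_KSC_on f c35 G par b ιB C37 C38 hι hG1 hpar hunit dB M₂ hM₂ hrepr hcR Cq hCq hC37 MInv aInv aW hMInv haInv haW _ _)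
  obtain ⟨Mo, ao, a', B', hao, ha', ha'a, hB', H⟩ := houtEGlob_KSC_on f c35 G par b ιB C37 C38 hG1 hM₂ hrepr hι hC37 c.1 c.2 a hc.1 hc.2 ha
  exact ⟨Mo, ao, a', B', hao, ha', ha'a, hB', H⟩

/-! ## §5  ★★★ The analytic-extension step of the record family on a subfamily (record pin `IsAnRecY r`) -/

/-- ★ **`StepAnalyticPos1` OF THE CODED FAMILY `KSC` AT THE CODED PREDICATE `IsAnKY`** — `stepAnalyticPos1_of_anFrame₂` on g8's `anFrame₂CodedOn` inhabited for
`KSC` (dictionaries `read342Y_KSC` ∕ `write342Y_KSC`; `writeAn` holds by definition of `IsAnKY`).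
[cite: Balaban1985BackgroundPropagators, Thm 3.4 p.400, (3.60)–(3.64) p.402, (3.35)–(3.37) p.396; Balaban1984PropagatorsII, Lemma 2.1 p.234, (2.51) p.232] -/
theorem stepAnalyticPos1_KSC_on (hι : ∀ (j : J) (s : BlkY (f j).toKIdx), β (f j).toKIdx.hN (f j).toKIdx.D (f j).toKIdx.hk (ιB j s) = s)
    (hG1 : ∀ u : 𝔸ˣ, u ∈ G → ‖(u : 𝔸)‖ ≤ 1) (hpar : ∀ j (U : CfgY 𝔸 (f j).toKIdx), GVal G (f j).toKIdx U → ∀ z w, par j U z w ∈ G)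
    (hunit : ∀ j (U : CfgY 𝔸 (f j).toKIdx), GVal G (f j).toKIdx U → IsUnit (deltaPrimeAY (f j).toKIdx (par j) U))
    (dB : ℕ) (M₂ : ℝ) (hM₂ : 0 ≤ M₂) (hrepr : ∀ (v : 𝔸) (j : ι), |b.repr v j| ≤ M₂ * ‖v‖) (hcR : 0 < M₂ * ∑ j, ‖b j‖)
    (Cq : ℝ) (hCq : 0 ≤ Cq) (hC37 : ∀ j β' U a, C37 j β' U a → GVal G (f j).toKIdx U ∧ CplxLettersY G (f j) (par j) (ιB j) Cq β' U a)
    (MInv aInv aW : ℝ) (hMInv : 0 < MInv) (haInv : 0 < aInv) (haW : 0 < aW)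
    (GA : ∀ j : J, B9.KernelFamily (geo9Y (f j)) (codingYx G (f j) (C37 j) (C38 j)).bg)
    (Cinv : ∀ j : J, B9.SiteKernel (geo9Y (f j)) (codingYx G (f j) (C37 j) (C38 j)).bg) :
    StepAnalyticPos1 dB c35 (fun j => geo9Y (f j)) (fun j => (codingYx G (f j) (C37 j) (C38 j)).bg) (fun j => KSC G (f j) (par j) (C37 j) (C38 j)) GA Cinv
      (fun j => IsAnKY G (f j) (par j) b (C37 j) (C38 j)) (fun j => KSC G (f j) (par j) (C37 j) (C38 j)) :=
  stepAnalyticPos1_of_anFrame₂ (d := dB)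
    (anFrame₂CodedOn f c35 G b C37 C38 par ιB (fun j => KSC G (f j) (par j) (C37 j) (C38 j)) hι hG1 hpar hunit dB M₂ hM₂ hrepr Cq hCq hC37
      (M₂ * ∑ j, ‖b j‖) hcR (fun B _ => (M₂ * ∑ j, ‖b j‖) * B + 1) (fun B _ hB _ => by positivity) (fun δ => δ) (fun δ hδ => hδ)
      MInv aInv aW hMInv haInv haW (fun j => read342Y_KSC G (f j) (par j) b (ιB j) (C37 j) (C38 j) (hι j) M₂ hM₂ hrepr c35 MInv aInv)
      (fun j => write342Y_KSC G (f j) (par j) b (ιB j) (C37 j) (C38 j) (hι j) M₂ hM₂ hrepr aW fun β' U a h => (hC37 j β' U a h).1))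
    GA Cinv

include C38 in
/-- ★★★ **`StepAnalyticPos1` OF THE RECORD FAMILY ON A SUBFAMILY AT g8's RECORD PIN `IsAnRecY r`** (for every rescaling `r > 0`; input families: the record's
`kernelFamilyS … (GpY par) par`, `GA`, `Cinv` over `bg9Y`): from §5's coded step by the generic transfer `stepPos_of_family_pos` (§2's `hin`; the output
statement is unchanged — `IsAnKY` does not read the kernel family) and `stepPos_base_of_coded` (`IsAnKY` at `(base U, r·β)` IS `IsAnRecY r` at `(U, β)`).
Displayed: the root frame's structural data only (no class implication is needed for a base-read output; no plaquette law); the coded class `C38` is a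
free parameter of the coding used in the proof.
[cite: Balaban1985BackgroundPropagators, Thm 3.4 p.400 («extend to configurations U′U … as analytic functions of A′»), (3.60)–(3.64) p.402, (3.35)–(3.37) p.396; Balaban1984PropagatorsII, Lemma 2.1 p.234] -/
theorem stepAnalyticPos1_record_on (hι : ∀ (j : J) (s : BlkY (f j).toKIdx), β (f j).toKIdx.hN (f j).toKIdx.D (f j).toKIdx.hk (ιB j s) = s)
    (hG1 : ∀ u : 𝔸ˣ, u ∈ G → ‖(u : 𝔸)‖ ≤ 1) (hpar : ∀ j (U : CfgY 𝔸 (f j).toKIdx), GVal G (f j).toKIdx U → ∀ z w, par j U z w ∈ G)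
    (hunit : ∀ j (U : CfgY 𝔸 (f j).toKIdx), GVal G (f j).toKIdx U → IsUnit (deltaPrimeAY (f j).toKIdx (par j) U))
    (dB : ℕ) (M₂ : ℝ) (hM₂ : 0 ≤ M₂) (hrepr : ∀ (v : 𝔸) (j : ι), |b.repr v j| ≤ M₂ * ‖v‖) (hcR : 0 < M₂ * ∑ j, ‖b j‖)
    (Cq : ℝ) (hCq : 0 ≤ Cq) (hC37 : ∀ j β' U a, C37 j β' U a → GVal G (f j).toKIdx U ∧ CplxLettersY G (f j) (par j) (ιB j) Cq β' U a)
    (MInv aInv aW : ℝ) (hMInv : 0 < MInv) (haInv : 0 < aInv) (haW : 0 < aW)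
    (GA : ∀ j : J, B9.KernelFamily (geo9Y (f j)) (bg9Y 𝔸 G (f j))) (Cinv : ∀ j : J, B9.SiteKernel (geo9Y (f j)) (bg9Y 𝔸 G (f j)))
    {r : ℝ} (hr : 0 < r) :
    StepAnalyticPos1 dB c35 (fun j => geo9Y (f j)) (fun j => bg9Y 𝔸 G (f j))
      (fun j => kernelFamilyS (f j).toKIdx (bg9Y 𝔸 G (f j)) (fun U => U) (GpY (f j).toKIdx (par j)) (par j)) GA Cinv
      (fun j => IsAnRecY G (f j) (par j) b (C37 j) r)
      (fun j => kernelFamilyS (f j).toKIdx (bg9Y 𝔸 G (f j)) (fun U => U) (GpY (f j).toKIdx (par j)) (par j)) := by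
  refine stepPos_base_of_coded dB c35 (fun j => geo9Y (f j)) (fun j => bg9Y 𝔸 G (f j))
    (fun j => kernelFamilyS (f j).toKIdx (bg9Y 𝔸 G (f j)) (fun U => U) (GpY (f j).toKIdx (par j)) (par j)) GA Cinv
    (fun j => codingYx G (f j) (C37 j) (C38 j)) (C := PUnit) (pos := fun _ => True)
    (fun _ j V α => IsAnKY G (f j) (par j) b (C37 j) (C38 j) (KSC G (f j) (par j) (C37 j) (C38 j)) V α)
    (fun _ j U α => IsAnRecY G (f j) (par j) b (C37 j) r
      (kernelFamilyS (f j).toKIdx (bg9Y 𝔸 G (f j)) (fun U => U) (GpY (f j).toKIdx (par j)) (par j)) U α)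
    hr (fun _ j U β h => h) ?_
  refine stepPos_of_family_pos dB c35 (fun j => geo9Y (f j)) (fun j => (codingYx G (f j) (C37 j) (C38 j)).bg)
    (fun j => KSC G (f j) (par j) (C37 j) (C38 j))
    (fun j => pullK (codingYx G (f j) (C37 j) (C38 j)) (kernelFamilyS (f j).toKIdx (bg9Y 𝔸 G (f j)) (fun U => U) (GpY (f j).toKIdx (par j)) (par j)))
    (fun j => pullK (codingYx G (f j) (C37 j) (C38 j)) (GA j)) (fun j => pullK (codingYx G (f j) (C37 j) (C38 j)) (GA j))
    (fun j => pullS (codingYx G (f j) (C37 j) (C38 j)) (Cinv j))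
    (C₁ := PUnit) (C₂ := PUnit) (pos₁ := fun _ => True) (pos₂ := fun _ => True)
    (Out₁ := fun _ j V α => IsAnKY G (f j) (par j) b (C37 j) (C38 j) (KSC G (f j) (par j) (C37 j) (C38 j)) V α)
    (Out₂ := fun _ j V α => IsAnKY G (f j) (par j) b (C37 j) (C38 j) (KSC G (f j) (par j) (C37 j) (C38 j)) V α)
    (hin_KSC_on_pos f c35 G par b ιB C37 C38 hι hG1 hM₂ hrepr dB _ _)
    (fun c hc a ha => ⟨0, 1, a, c, one_pos, ha, le_rfl, hc, fun _ _ _ _ _ _ _ _ _ _ h => h⟩)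
    (stepAnalyticPos1_KSC_on f c35 G par b ιB C37 C38 hι hG1 hpar hunit dB M₂ hM₂ hrepr hcR Cq hCq hC37 MInv aInv aW hMInv haInv haW _ _)

include C38 in
/-- ★★★ **`StepAnalyticPos` (BOTH HALVES, `G′` AND THE SHARED `GA`) OF THE RECORD FAMILY ON A SUBFAMILY AT THE PIN `IsAnRecY r`**: the pin does not read the
kernel family, so the `GA` half is the `G′` half (`stepAnalyticPos_of_halves`). [cite: Balaban1985BackgroundPropagators, Thm 3.4 p.400, (3.62)–(3.64) p.402, (3.86) p.407] -/
theorem stepAnalyticPos_record_on (hι : ∀ (j : J) (s : BlkY (f j).toKIdx), β (f j).toKIdx.hN (f j).toKIdx.D (f j).toKIdx.hk (ιB j s) = s)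
    (hG1 : ∀ u : 𝔸ˣ, u ∈ G → ‖(u : 𝔸)‖ ≤ 1) (hpar : ∀ j (U : CfgY 𝔸 (f j).toKIdx), GVal G (f j).toKIdx U → ∀ z w, par j U z w ∈ G)
    (hunit : ∀ j (U : CfgY 𝔸 (f j).toKIdx), GVal G (f j).toKIdx U → IsUnit (deltaPrimeAY (f j).toKIdx (par j) U))
    (dB : ℕ) (M₂ : ℝ) (hM₂ : 0 ≤ M₂) (hrepr : ∀ (v : 𝔸) (j : ι), |b.repr v j| ≤ M₂ * ‖v‖) (hcR : 0 < M₂ * ∑ j, ‖b j‖)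
    (Cq : ℝ) (hCq : 0 ≤ Cq) (hC37 : ∀ j β' U a, C37 j β' U a → GVal G (f j).toKIdx U ∧ CplxLettersY G (f j) (par j) (ιB j) Cq β' U a)
    (MInv aInv aW : ℝ) (hMInv : 0 < MInv) (haInv : 0 < aInv) (haW : 0 < aW)
    (GA : ∀ j : J, B9.KernelFamily (geo9Y (f j)) (bg9Y 𝔸 G (f j))) (Cinv : ∀ j : J, B9.SiteKernel (geo9Y (f j)) (bg9Y 𝔸 G (f j)))
    {r : ℝ} (hr : 0 < r) :
    StepAnalyticPos dB c35 (fun j => geo9Y (f j)) (fun j => bg9Y 𝔸 G (f j))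
      (fun j => kernelFamilyS (f j).toKIdx (bg9Y 𝔸 G (f j)) (fun U => U) (GpY (f j).toKIdx (par j)) (par j)) GA Cinv
      (fun j => IsAnRecY G (f j) (par j) b (C37 j) r) := by
  have h := stepAnalyticPos1_record_on f c35 G par b ιB C37 C38 hι hG1 hpar hunit dB M₂ hM₂ hrepr hcR Cq hCq hC37 MInv aInv aW hMInv haInv haW
    GA Cinv hr
  exact stepAnalyticPos_of_halves h h

end Literature.MathematicalPhysics.QuantumFieldTheory.Balaban1983to89.B9SectBEGlobAnStepRecordOn

end
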